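import Summits.Ventures.DiscreteObjects.Hadamard.ConferenceGraph333PGroupFixed
import Summits.Ventures.DiscreteObjects.Hadamard.ConferenceGraph333Order13

/-!
# 5² ∤ |Aut| and 7² ∤ |Aut| for srg(333,166,82,83): |Aut| divides 2^a · 3^b · 5 · 7 · 11 · 37 · 41 · 83 (kernel)

Framing: lottery ticket; floor = certified bounds/negative ranges.  Cell pub-namedobj (venture DiscreteObjects),
target (H) = `H(668)`, hadamard gen 30.  Group-level consequences of the fixed-structure tools
(`ConferenceGraph333FixedSubgraph`, `ConferenceGraph333PGroupFixed`) for the automorphism group of a hypothetical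
`srg(333,166,82,83)` ⇔ symmetric `C(334)` (⇒ `H(668)`).
* **`autGroup_orbit_bound`** — the orbit bound of gen 29 for GROUP orbits: if `O` (|O| = L ≥ 2) lies in one orbit of a
  group `G` of automorphisms and `F` consists of common fixed vertices of `G`, then `L · (|F| + 1) ≤ 333` (for `y ∈ F`
  the Seidel entries `S_{y,x}`, `x ∈ O`, are all equal, so `(S·1_O)_y = ±L`, while `‖S·1_O‖² = 333L − L²`).
* `fixed_four_false_7` (`p = 7`, `|F| = 4`: an `F`-degree `≡ 166 ≡ 5 (mod 7)` does not fit in `[0,3]`),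
  `fixed_eight_false_5` (`p = 5`, `|F| = 8`: degrees `≡ 1 (mod 5)` lie in `{1,6}`; degree `1` contradicts
  `λ ≡ 2 (mod 5)`, all degrees `6` gives `μ ∈ [4,6]` for a non-adjacent pair, but `μ ≡ 3 (mod 5)`).
* `sum_card_fixed_eq_sum_card_stab` (double counting `Σ_g |Fix g| = Σ_x |Stab x|`), `orbit_mul_stab_card`
  (orbit–stabiliser, finset form).
* **`autGroup_card_not_dvd_5_sq`**, **`autGroup_card_not_dvd_7_sq`**.  Proof for a subgroup `P` of order `p²`
  (`p = 5, 7`): every `g ≠ 1` in `P` has order `p` (orders `25`, `49` are excluded) and at most `53` resp. `39` fixed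
  points, so `Σ_{g ∈ P} |Fix g| ≤ 333 + (p²−1)·f_max = 1605` resp. `2205`.  If every orbit has length `≤ p` then every
  stabiliser has order `≥ p` and `Σ_g |Fix g| = Σ_x |Stab x| ≥ 333p = 1665` resp. `2331` — contradiction.  Otherwise an
  orbit of length `p²` exists and the orbit bound gives `|Fix P| ≤ 12` resp. `≤ 5`; with `|Fix P| ≡ 333 (mod p)`:
  `|Fix P| ∈ {3, 8}` resp. `= 4`, excluded by the fixed-structure lemmas.
* **`autGroup_order_shape_g30b`** — for every group `G` of automorphisms and prime `p ∣ |G|`: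
  `p ∈ {2,3,5,7,11,37,41,83}` and `p² ∤ |G|` unless `p ∈ {2, 3}`; i.e. **`|G|` divides `2^a · 3^b · 48 475 735`**
  (`5·7·11·37·41·83`).
WORDS: structure of a HYPOTHETICAL object (no srg(333,166,82,83) / C(334) / H(668) is constructed or excluded); method
in print: orbit counting for automorphism groups of srgs/designs (Behbahani–Lam 2011 et al.); instance and kernel proofs
ours (PROVISIONAL).  No `sorry`, no new definitions.
-/

namespace Summit.Ventures.DiscreteObjects.Hadamard

open Finset MulAction

section sylow57
variable {V : Type*} [Fintype V] [DecidableEq V]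

/-! ## §1 The orbit bound for group orbits -/

/-- **Group orbit bound.**  `G` a group of automorphisms of an `srg(333,166,82,83)`, `F` a set of common fixed
vertices, `O` a set of `L ≥ 2` vertices inside one `G`-orbit (`∀ x ∈ O, ∃ g ∈ G, g x₀ = x`).  Then `L·(|F|+1) ≤ 333`. -/
theorem autGroup_orbit_bound (hV : Fintype.card V = 333) (A : Matrix V V ℤ)
    (h01 : ∀ x y, A x y = 0 ∨ A x y = 1) (hsymm : ∀ x y, A y x = A x y) (hdiag : ∀ x, A x x = 0)
    (hk : ∀ x, ∑ y, A x y = 166) (hsrg : ∀ x y, ∑ z, A x z * A z y = 83 * (1 + (if x = y then 1 else 0)) - A x y)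
    (G : Subgroup (Equiv.Perm V)) (hG : ∀ g ∈ G, ∀ x y, A (g x) (g y) = A x y)
    (F : Finset V) (hF : ∀ y ∈ F, ∀ g ∈ G, g y = y) (x₀ : V) (O : Finset V)
    (hO : ∀ x ∈ O, ∃ g ∈ G, g x₀ = x) (hL : 2 ≤ O.card) :
    O.card * (F.card + 1) ≤ 333 := by
  obtain ⟨hSd, hSo, hSs, -, hSS⟩ := seidel_identities_of_conferenceGraph A h01 hsymm hdiag 83
    (by rw [hV]; norm_num) (fun x => by rw [hk x]; norm_num) hsrg
  set S : V → V → ℤ := fun x y => 1 - (if x = y then 1 else 0) - 2 * A x y with hS_def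
  have hSS' : ∀ x y, ∑ z, S x z * S z y = 333 * (if x = y then 1 else 0) - 1 := fun x y => by
    rw [hSS x y, hV]; norm_num
  have hSg : ∀ g ∈ G, ∀ x y, S (g x) (g y) = S x y := fun g hg x y => by
    simp only [hS_def, hG g hg, g.injective.eq_iff]
  have hSs' : ∀ x y, S y x = S x y := fun x y => hSs x y
  have hSo' : ∀ x y, x ≠ y → S x y = 1 ∨ S x y = -1 := fun x y => hSo x y
  have hcol : ∀ a b, ∑ y, S y a * S y b = 333 * (if a = b then 1 else 0) - 1 := by
    intro a b
    rw [Finset.sum_congr rfl fun y _ => by rw [hSs' a y]]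
    exact hSS' a b
  set L : ℕ := O.card with hL_def
  have hOcard : O.card = L := rfl
  -- g y = Σ_{x ∈ O} S y x and Σ_y g(y)² = 333 L − L²
  set g : V → ℤ := fun y => ∑ x ∈ O, S y x with hg_def
  have hg2 : ∑ y, g y ^ 2 = 333 * L - L * L := by
    have e : ∀ y, g y ^ 2 = ∑ x ∈ O, ∑ x' ∈ O, S y x * S y x' := by
      intro y; rw [hg_def, sq, Finset.sum_mul_sum]
    rw [Finset.sum_congr rfl fun y _ => e y, Finset.sum_comm]
    rw [Finset.sum_congr rfl fun x _ => Finset.sum_comm]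
    simp_rw [hcol]
    have e2 : ∀ x ∈ O, ∑ x' ∈ O, ((333 : ℤ) * (if x = x' then 1 else 0) - 1) = 333 - L := by
      intro x hx
      rw [Finset.sum_sub_distrib, Finset.sum_const, ← Finset.mul_sum, Finset.sum_ite_eq, if_pos hx, hOcard]
      simp
    rw [Finset.sum_congr rfl e2, Finset.sum_const, hOcard, nsmul_eq_mul]
    ring
  -- fixed vertices: g y = L · S y x₀ = ± L
  have hfix : ∀ y ∈ F, g y ^ 2 = (L : ℤ) * L := by
    intro y hy
    have hyx : y ≠ x₀ := by
      rintro rfl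
      have hsub : O ⊆ {y} := by
        intro x hx
        obtain ⟨g', hg', hgx⟩ := hO x hx
        rw [Finset.mem_singleton, ← hgx, hF y hy g' hg']
      have := Finset.card_le_card hsub
      rw [Finset.card_singleton] at this
      omega
    have e : g y = ∑ x ∈ O, S y x₀ := by
      refine Finset.sum_congr rfl fun x hx => ?_
      obtain ⟨g', hg', hgx⟩ := hO x hx
      rw [← hgx]
      conv_lhs => rw [← hF y hy g' hg']
      exact hSg g' hg' y x₀
    rw [e, Finset.sum_const, hOcard, nsmul_eq_mul]
    rcases hSo' y x₀ hyx with h | h <;> rw [h] <;> ring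
  -- compare
  have hsplit := Finset.sum_filter_add_sum_filter_not (univ : Finset V) (fun y => y ∈ F) (fun y => g y ^ 2)
  rw [hg2] at hsplit
  have hFu : univ.filter (fun y => y ∈ F) = F := by ext y; simp
  rw [hFu] at hsplit
  have hFsum : ∑ y ∈ F, g y ^ 2 = (F.card : ℤ) * (L * L) := by
    rw [Finset.sum_congr rfl fun y hy => hfix y hy, Finset.sum_const, nsmul_eq_mul]
  have hM : 0 ≤ ∑ y ∈ univ.filter (fun y => ¬ y ∈ F), g y ^ 2 := Finset.sum_nonneg fun y _ => sq_nonneg _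
  have hineq : (F.card : ℤ) * (L * L) + L * L ≤ 333 * L := by linarith
  have hLpos : (0 : ℤ) < L := by exact_mod_cast (show 0 < L by omega)
  have h2 : (L : ℤ) * (F.card + 1) ≤ 333 := by nlinarith
  exact_mod_cast h2

/-! ## §2 Small common fixed sets -/

/-- `p = 7`, `|F| = 4` is impossible: an `F`-degree is `≡ 166 ≡ 5 (mod 7)` but lies in `[0, 3]`. -/
theorem fixed_four_false_7 (A : Matrix V V ℤ) (h01 : ∀ x y, A x y = 0 ∨ A x y = 1) (hdiag : ∀ x, A x x = 0)
    (hk : ∀ x, ∑ y, A x y = 166) (F : Finset V) (hF : F.card = 4)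
    (hrow : ∀ x ∈ F, ∃ a : ℤ, (∑ y ∈ F, A x y) + 7 * a = ∑ y, A x y) : False := by
  obtain ⟨x, hx⟩ : F.Nonempty := by rw [← Finset.card_pos, hF]; norm_num
  obtain ⟨a, ha⟩ := hrow x hx
  rw [hk x] at ha
  obtain ⟨h0, h1⟩ := sum_adj_bounds A h01 hdiag F hx
  rw [hF] at h1
  push_cast at h1
  omega

/-- `p = 5`, `|F| = 8` is impossible.  Degrees `≡ 1 (mod 5)` lie in `{1, 6}`; a vertex of degree `1` and its
neighbour have `λ = 0 ≢ 82 (mod 5)`; if all degrees are `6`, a vertex `x` and a non-neighbour `z` have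
`μ(x,z) ≥ 6 + 6 − 8 = 4` and `≤ 6`, but `μ ≡ 83 ≡ 3 (mod 5)`. -/
theorem fixed_eight_false_5 (A : Matrix V V ℤ) (h01 : ∀ x y, A x y = 0 ∨ A x y = 1) (hsymm : ∀ x y, A y x = A x y)
    (hdiag : ∀ x, A x x = 0) (hk : ∀ x, ∑ y, A x y = 166)
    (hsrg : ∀ x y, ∑ z, A x z * A z y = 83 * (1 + (if x = y then 1 else 0)) - A x y)
    (F : Finset V) (hF : F.card = 8)
    (hrow : ∀ x ∈ F, ∃ a : ℤ, (∑ y ∈ F, A x y) + 5 * a = ∑ y, A x y)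
    (hpair : ∀ x ∈ F, ∀ y ∈ F, ∃ b : ℤ, (∑ z ∈ F, A x z * A z y) + 5 * b = ∑ z, A x z * A z y) : False := by
  have hge : ∀ u w, 0 ≤ A u w := fun u w => by rcases h01 u w with h | h <;> simp [h]
  have hle : ∀ u w, A u w ≤ 1 := fun u w => by rcases h01 u w with h | h <;> simp [h]
  -- degrees are 1 or 6
  have hdeg : ∀ x ∈ F, ∑ y ∈ F, A x y = 1 ∨ ∑ y ∈ F, A x y = 6 := by
    intro x hx
    obtain ⟨a, ha⟩ := hrow x hx
    rw [hk x] at ha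
    obtain ⟨h0, h1⟩ := sum_adj_bounds A h01 hdiag F hx
    rw [hF] at h1
    push_cast at h1
    omega
  -- no degree 1
  have hdeg6 : ∀ x ∈ F, ∑ y ∈ F, A x y = 6 := by
    intro x hx
    rcases hdeg x hx with h1 | h6
    · exfalso
      -- the unique neighbour y of x in F
      obtain ⟨y, hy, hAxy⟩ : ∃ y ∈ F, A x y = 1 := by
        by_contra hc
        push Not at hc
        have : ∑ y ∈ F, A x y = 0 := Finset.sum_eq_zero fun y hy => by
          rcases h01 x y with h | h
          · exact h
          · exact absurd h (hc y hy)
        omega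
      obtain ⟨b, hb⟩ := hpair x hx y hy
      have hxy : x ≠ y := by rintro rfl; rw [hdiag] at hAxy; norm_num at hAxy
      rw [hsrg x y, if_neg hxy, hAxy] at hb
      obtain ⟨hl0, hl1⟩ := sum_adj_mul_bounds A h01 hdiag F x hy
      rw [h1, hAxy] at hl1
      omega
    · exact h6
  -- a non-neighbour z of x inside F
  obtain ⟨x, hx⟩ : F.Nonempty := by rw [← Finset.card_pos, hF]; norm_num
  obtain ⟨z, hz, hzx, hAxz⟩ : ∃ z ∈ F, z ≠ x ∧ A x z = 0 := by
    by_contra hc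
    push Not at hc
    have h7 : ∑ y ∈ F, A x y = 7 := by
      rw [← Finset.sum_erase_add _ _ hx, hdiag, add_zero]
      have : ∀ y ∈ F.erase x, A x y = 1 := fun y hy => by
        rcases h01 x y with h | h
        · exact absurd h (hc y (Finset.mem_of_mem_erase hy) (Finset.ne_of_mem_erase hy))
        · exact h
      rw [Finset.sum_congr rfl this, Finset.sum_const, Finset.card_erase_of_mem hx, hF]; norm_num
    have := hdeg6 x hx
    omega
  obtain ⟨b, hb⟩ := hpair x hx z hz
  rw [hsrg x z, if_neg (Ne.symm hzx), hAxz] at hb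
  obtain ⟨hl0, hl1⟩ := sum_adj_mul_bounds A h01 hdiag F x hz
  rw [hdeg6 x hx, hAxz] at hl1
  -- lower bound μ ≥ deg x + deg z − |F| = 4
  have hlow : ∑ w ∈ F, (A x w + A w z - 1) ≤ ∑ w ∈ F, A x w * A w z :=
    Finset.sum_le_sum fun w _ => by nlinarith [hge x w, hle x w, hge w z, hle w z]
  rw [Finset.sum_sub_distrib, Finset.sum_add_distrib, Finset.sum_const, hF, hdeg6 x hx,
    Finset.sum_congr rfl fun w _ => hsymm z w, hdeg6 z hz] at hlow
  norm_num at hlow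
  omega

/-! ## §3 Counting for a finite group of permutations -/

/-- **Double counting** `Σ_g |Fix g| = Σ_x |Stab x|`. -/
theorem sum_card_fixed_eq_sum_card_stab (P : Subgroup (Equiv.Perm V)) [Fintype P] :
    ∑ g : P, (univ.filter fun y : V => (g : Equiv.Perm V) y = y).card =
      ∑ y : V, (univ.filter fun g : P => (g : Equiv.Perm V) y = y).card := by
  simp only [Finset.card_filter]
  exact Finset.sum_comm

/-- **Orbit–stabiliser** in finset form: `|orbit x| · |Stab x| = |P|`. -/
theorem orbit_mul_stab_card (P : Subgroup (Equiv.Perm V)) [Fintype P] (x : V) :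
    (univ.filter fun y : V => ∃ g : P, (g : Equiv.Perm V) x = y).card *
      (univ.filter fun g : P => (g : Equiv.Perm V) x = x).card = Fintype.card P := by
  classical
  have h := MulAction.card_orbit_mul_card_stabilizer_eq_card_group P x
  rw [Fintype.card_of_subtype (univ.filter fun y : V => ∃ g : P, (g : Equiv.Perm V) x = y)
      (fun y => by simp only [Finset.mem_filter, Finset.mem_univ, true_and, MulAction.mem_orbit_iff]; rfl),
    Fintype.card_of_subtype (univ.filter fun g : P => (g : Equiv.Perm V) x = x)
      (fun g => by simp only [Finset.mem_filter, Finset.mem_univ, true_and, MulAction.mem_stabilizer_iff]; rfl)] at h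
  exact h

/-- elements of a subgroup of order `p²` of automorphisms have `g^p = 1` once order `p²` is excluded, and then few fixed
points: the two instances `p = 5` (`≤ 53`) and `p = 7` (`≤ 39`). -/
theorem sq_subgroup_fixed_le (hV : Fintype.card V = 333) (A : Matrix V V ℤ)
    (h01 : ∀ x y, A x y = 0 ∨ A x y = 1) (hsymm : ∀ x y, A y x = A x y) (hdiag : ∀ x, A x x = 0)
    (hk : ∀ x, ∑ y, A x y = 166) (hsrg : ∀ x y, ∑ z, A x z * A z y = 83 * (1 + (if x = y then 1 else 0)) - A x y)
    (P : Subgroup (Equiv.Perm V)) (hPA : ∀ g ∈ P, ∀ x y, A (g x) (g y) = A x y) {p : ℕ} (hp : p = 5 ∨ p = 7)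
    (hP : Nat.card P = p ^ 2) (g : P) (hg1 : g ≠ 1) :
    (g : Equiv.Perm V) ^ p = 1 ∧ (univ.filter fun y => (g : Equiv.Perm V) y = y).card ≤ (if p = 5 then 53 else 39) := by
  set γ : Equiv.Perm V := (g : Equiv.Perm V) with hγ
  have hγA : ∀ x y, A (γ x) (γ y) = A x y := hPA γ g.2
  have hne : γ ≠ 1 := fun e => hg1 (Subtype.ext e)
  have hord : orderOf γ ∣ p ^ 2 := by rw [hγ, Subgroup.orderOf_coe, ← hP]; exact orderOf_dvd_natCard g
  have hpp : γ ^ (p ^ 2) = 1 := orderOf_dvd_iff_pow_eq_one.mp hord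
  rcases hp with rfl | rfl
  · have h5 : γ ^ 5 = 1 := by
      by_contra h5
      exact no_aut_order_25 hV A h01 hsymm hdiag hk hsrg γ (by simpa using hpp) h5 hγA
    obtain ⟨-, w5, -⟩ := aut_prime_windows_fs hV A h01 hsymm hdiag hk hsrg (by norm_num : Nat.Prime 5) (by norm_num)
      γ h5 hne hγA
    exact ⟨h5, by rw [if_pos rfl]; exact (w5 rfl).2.2⟩
  · have h7 : γ ^ 7 = 1 := by
      by_contra h7
      exact no_aut_order_49 hV A h01 hsymm hdiag hk hsrg γ (by simpa using hpp) h7 hγA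
    have w7 := aut_order7_fixed hV A h01 hsymm hdiag hk hsrg γ h7 hne hγA
    refine ⟨h7, ?_⟩
    rw [if_neg (by norm_num)]
    rcases w7 with h | h <;> omega

/-- **No subgroup of order `p²` for `p ∈ {5, 7}`.** -/
theorem no_subgroup_card_sq_5_7 (hV : Fintype.card V = 333) (A : Matrix V V ℤ)
    (h01 : ∀ x y, A x y = 0 ∨ A x y = 1) (hsymm : ∀ x y, A y x = A x y) (hdiag : ∀ x, A x x = 0)
    (hk : ∀ x, ∑ y, A x y = 166) (hsrg : ∀ x y, ∑ z, A x z * A z y = 83 * (1 + (if x = y then 1 else 0)) - A x y)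
    (P : Subgroup (Equiv.Perm V)) (hPA : ∀ g ∈ P, ∀ x y, A (g x) (g y) = A x y) {p : ℕ} (hp : p = 5 ∨ p = 7)
    (hP : Nat.card P = p ^ 2) : False := by
  classical
  haveI : Fintype P := Fintype.ofFinite P
  have hPc : Fintype.card P = p ^ 2 := by rw [← Nat.card_eq_fintype_card, hP]
  have hpr : p.Prime := by rcases hp with rfl | rfl <;> norm_num
  haveI := Fact.mk hpr
  have hPgrp : IsPGroup p P := IsPGroup.of_card hP
  -- the common fixed set
  set F : Finset V := univ.filter fun y => ∀ g ∈ P, g y = y with hF_def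
  have hFmem : ∀ y, y ∈ F ↔ ∀ g ∈ P, g y = y := fun y => by simp [hF_def]
  have hFfix : ∀ y ∈ F, ∀ g ∈ P, g y = y := fun y hy => (hFmem y).mp hy
  obtain ⟨a, ha⟩ := pgroup_card_fixed_congr hV P hPgrp F hFmem
  -- Σ_g |Fix g| ≤ 333 + (p² − 1) f_max
  set fmax : ℕ := if p = 5 then 53 else 39 with hfmax
  have helt := fun g hg => (sq_subgroup_fixed_le hV A h01 hsymm hdiag hk hsrg P hPA hp hP g hg).2
  have hT : ∑ g : P, (univ.filter fun y => (g : Equiv.Perm V) y = y).card ≤ 333 + (p ^ 2 - 1) * fmax := by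
    rw [← Finset.sum_erase_add _ _ (Finset.mem_univ (1 : P))]
    have h1 : (univ.filter fun y => ((1 : P) : Equiv.Perm V) y = y).card = 333 := by
      rw [← hV, ← Finset.card_univ]; congr 1; ext y; simp
    have h2 := Finset.sum_le_card_nsmul (univ.erase (1 : P)) (fun g => (univ.filter fun y => (g : Equiv.Perm V) y = y).card)
      fmax (fun g hg => helt g (Finset.ne_of_mem_erase hg))
    rw [Finset.card_erase_of_mem (Finset.mem_univ _), Finset.card_univ, hPc, smul_eq_mul] at h2
    omega
  by_cases hbig : ∃ x₀, p < (univ.filter fun y : V => ∃ g : P, (g : Equiv.Perm V) x₀ = y).card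
  · -- an orbit of length p²: orbit bound
    obtain ⟨x₀, hx₀⟩ := hbig
    set O := univ.filter fun y : V => ∃ g : P, (g : Equiv.Perm V) x₀ = y with hO_def
    have hos := orbit_mul_stab_card P x₀
    rw [hPc] at hos
    have hOdvd : O.card ∣ p ^ 2 := Dvd.intro _ hos
    obtain ⟨i, hi, hOi⟩ := (Nat.dvd_prime_pow hpr).mp hOdvd
    have hO2 : O.card = p ^ 2 := by
      interval_cases i
      · rw [pow_zero] at hOi; omega
      · rw [pow_one] at hOi; omega
      · exact hOi
    have hOmem : ∀ x ∈ O, ∃ g ∈ P, g x₀ = x := fun x hx => by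
      obtain ⟨g, hg⟩ := (Finset.mem_filter.mp hx).2
      exact ⟨g, g.2, hg⟩
    have hbound := autGroup_orbit_bound hV A h01 hsymm hdiag hk hsrg P hPA F hFfix x₀ O hOmem
      (by rw [hO2]; rcases hp with rfl | rfl <;> norm_num)
    rw [hO2] at hbound
    have hrow := fun x (hx : x ∈ F) => pgroup_fixed_row_congr A h01 P hPgrp hPA F hFmem (x := x) (hFfix x hx)
    have hpair := fun x (hx : x ∈ F) y (hy : y ∈ F) =>
      pgroup_fixed_pair_congr A h01 P hPgrp hPA F hFmem (x := x) (y := y) (hFfix x hx) (hFfix y hy)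
    rcases hp with rfl | rfl
    · -- p = 5: |F| ≤ 12, |F| ≡ 3 (mod 5) ⇒ |F| ∈ {3, 8}
      push_cast at ha
      have hF38 : F.card = 3 ∨ F.card = 8 := by omega
      rcases hF38 with h3 | h8
      · exact fixed_three_false A h01 hsymm hdiag hk (Or.inr rfl) F h3 hrow
      · exact fixed_eight_false_5 A h01 hsymm hdiag hk hsrg F h8 hrow hpair
    · -- p = 7: |F| ≤ 5, |F| ≡ 4 (mod 7) ⇒ |F| = 4
      push_cast at ha
      have hF4 : F.card = 4 := by omega
      exact fixed_four_false_7 A h01 hdiag hk F hF4 hrow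
  · -- all orbits of length ≤ p: stabilisers have order ≥ p, Σ_x |Stab x| ≥ 333 p
    push Not at hbig
    have hstab : ∀ y : V, p ≤ (univ.filter fun g : P => (g : Equiv.Perm V) y = y).card := by
      intro y
      have hos := orbit_mul_stab_card P y
      rw [hPc] at hos
      have hy := hbig y
      by_contra hlt
      push Not at hlt
      have : (univ.filter fun y' : V => ∃ g : P, (g : Equiv.Perm V) y = y').card *
          (univ.filter fun g : P => (g : Equiv.Perm V) y = y).card < p * p :=
        Nat.mul_lt_mul_of_le_of_lt hy hlt (by omega)
      rw [hos, sq] at this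
      exact lt_irrefl _ this
    have hlow := Finset.card_nsmul_le_sum (univ : Finset V) (fun y => (univ.filter fun g : P => (g : Equiv.Perm V) y = y).card)
      p (fun y _ => hstab y)
    rw [Finset.card_univ, hV, smul_eq_mul, ← sum_card_fixed_eq_sum_card_stab P] at hlow
    rcases hp with rfl | rfl
    · simp only [hfmax] at hT; norm_num at hT; omega
    · simp only [hfmax] at hT; norm_num at hT; omega

/-! ## §4 Group level -/

/-- **`5² ∤ |G|`** for every group `G` of automorphisms of an `srg(333,166,82,83)`. -/
theorem autGroup_card_not_dvd_5_sq (hV : Fintype.card V = 333) (A : Matrix V V ℤ)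
    (h01 : ∀ x y, A x y = 0 ∨ A x y = 1) (hsymm : ∀ x y, A y x = A x y) (hdiag : ∀ x, A x x = 0)
    (hk : ∀ x, ∑ y, A x y = 166) (hsrg : ∀ x y, ∑ z, A x z * A z y = 83 * (1 + (if x = y then 1 else 0)) - A x y)
    (G : Subgroup (Equiv.Perm V)) (hG : ∀ g ∈ G, ∀ x y, A (g x) (g y) = A x y) :
    ¬ 5 ^ 2 ∣ Nat.card G := by
  intro hdvd
  haveI : Fact (Nat.Prime 5) := ⟨by norm_num⟩
  obtain ⟨K, hK⟩ := Sylow.exists_subgroup_card_pow_prime 5 hdvd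
  have hP : Nat.card (K.map G.subtype) = 5 ^ 2 := by
    rw [Subgroup.card_map_of_injective G.subtype_injective, hK]
  exact no_subgroup_card_sq_5_7 hV A h01 hsymm hdiag hk hsrg (K.map G.subtype)
    (fun g hg => hG g (Subgroup.map_subtype_le K hg)) (Or.inl rfl) hP

/-- **`7² ∤ |G|`** for every group `G` of automorphisms of an `srg(333,166,82,83)`. -/
theorem autGroup_card_not_dvd_7_sq (hV : Fintype.card V = 333) (A : Matrix V V ℤ)
    (h01 : ∀ x y, A x y = 0 ∨ A x y = 1) (hsymm : ∀ x y, A y x = A x y) (hdiag : ∀ x, A x x = 0)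
    (hk : ∀ x, ∑ y, A x y = 166) (hsrg : ∀ x y, ∑ z, A x z * A z y = 83 * (1 + (if x = y then 1 else 0)) - A x y)
    (G : Subgroup (Equiv.Perm V)) (hG : ∀ g ∈ G, ∀ x y, A (g x) (g y) = A x y) :
    ¬ 7 ^ 2 ∣ Nat.card G := by
  intro hdvd
  haveI : Fact (Nat.Prime 7) := ⟨by norm_num⟩
  obtain ⟨K, hK⟩ := Sylow.exists_subgroup_card_pow_prime 7 hdvd
  have hP : Nat.card (K.map G.subtype) = 7 ^ 2 := by
    rw [Subgroup.card_map_of_injective G.subtype_injective, hK]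
  exact no_subgroup_card_sq_5_7 hV A h01 hsymm hdiag hk hsrg (K.map G.subtype)
    (fun g hg => hG g (Subgroup.map_subtype_le K hg)) (Or.inr rfl) hP

/-- **Shape of `|Aut|` (gen 30, final form of this file).**  For every group `G` of automorphisms of an
`srg(333,166,82,83)` and every prime `p ∣ |G|`: `p ∈ {2,3,5,7,11,37,41,83}`, and `p² ∤ |G|` unless `p ∈ {2,3}` —
i.e. `|G|` divides `2^a · 3^b · 5 · 7 · 11 · 37 · 41 · 83` for some `a, b`. -/
theorem autGroup_order_shape_g30b (hV : Fintype.card V = 333) (A : Matrix V V ℤ)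
    (h01 : ∀ x y, A x y = 0 ∨ A x y = 1) (hsymm : ∀ x y, A y x = A x y) (hdiag : ∀ x, A x x = 0)
    (hk : ∀ x, ∑ y, A x y = 166) (hsrg : ∀ x y, ∑ z, A x z * A z y = 83 * (1 + (if x = y then 1 else 0)) - A x y)
    (G : Subgroup (Equiv.Perm V)) (hG : ∀ g ∈ G, ∀ x y, A (g x) (g y) = A x y) {p : ℕ} (hp : p.Prime)
    (hdvd : p ∣ Nat.card G) :
    (p = 2 ∨ p = 3 ∨ p = 5 ∨ p = 7 ∨ p = 11 ∨ p = 37 ∨ p = 41 ∨ p = 83) ∧ (p ≠ 2 → p ≠ 3 → ¬ p ^ 2 ∣ Nat.card G) := by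
  obtain ⟨hmem, hsq⟩ := autGroup_order_shape_g30 hV A h01 hsymm hdiag hk hsrg G hG hp hdvd
  refine ⟨hmem, fun h2 h3 => ?_⟩
  rcases hmem with rfl | rfl | rfl | rfl | rfl | rfl | rfl | rfl
  · exact absurd rfl h2
  · exact absurd rfl h3
  · exact autGroup_card_not_dvd_5_sq hV A h01 hsymm hdiag hk hsrg G hG
  · exact autGroup_card_not_dvd_7_sq hV A h01 hsymm hdiag hk hsrg G hG
  · exact hsq (Or.inl rfl)
  · exact hsq (Or.inr (Or.inl rfl))
  · exact hsq (Or.inr (Or.inr (Or.inl rfl)))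
  · exact hsq (Or.inr (Or.inr (Or.inr rfl)))

end sylow57

end Summit.Ventures.DiscreteObjects.Hadamard
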